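import Summits.RiemannHypothesis.RiemannHypothesis.Theorems.WeilParityOffLineParityDetectionLocLaplace
import Summits.RiemannHypothesis.RiemannHypothesis.Theorems.WeilParityOffLineParityDetectionTrialTransforms
import HarnessLib

/-!
# Layer bounds for two-term exponential transforms (helper file for stub LOC)

Route `WeilParity`, crux `OffLineParityDetection` (item stmt-RiemannHypothesis-15431), line
`registered`, stub `stub_finiteDefectLocalisation` (LOC).  Pure complex-number algebra, no zeta
facts and no definitions.  On the line the transforms of the odd witness and of the even
competitors have the two-term shape

  `X(ρ) = e^{(ρ-1/2)a} F(ρ) - e^{-(ρ-1/2)a} G(ρ)`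

(`G = 0` in the even case).  For non-negative weights `w` this file bounds the weighted sums
`Σ w(ρ) Re X(ρ)²` over a finite set of points `ρ`:

* TOP LAYER `Re ρ = 1/2 + η₀` (`η₀ ≥ 0`, `a ≥ 0`), `loc_layer_top`:
  `Σ w Re X² ≥ e^{2η₀a} Σ w Re(e^{2i(Im ρ)a} F²) - Σ w (‖F‖ + ‖G‖)²`
  (`X² = e^{2(ρ-1/2)a}F² - 2FG + e^{-2(ρ-1/2)a}G²`, `(e^{(ρ-1/2)a})² = e^{2η₀a} e^{2i(Im ρ)a}`);
* LOWER LAYERS `|Re ρ - 1/2| ≤ η'` (`η' ≥ 0`, `a ≥ 0`), `loc_layer_low`: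
  `Σ w Re X² ≥ -e^{2η'a} Σ w (‖F‖ + ‖G‖)²` (`Re X² ≥ -‖X‖²`, `‖e^{±(ρ-1/2)a}‖ ≤ e^{η'a}`).
-/

set_option linter.dupNamespace false

noncomputable section

namespace Summit.RiemannHypothesis.RiemannHypothesis.Theorems.WeilParityOffLineParityDetection

open Set Filter Finset
open scoped ComplexConjugate
open Literature.NumberTheory.LFunctions

/-- `Re (A - B)² ≥ Re A² - (2‖A‖‖B‖ + ‖B‖²)`. [folklore] -/
theorem loc_re_sub_sq_ge (A B : ℂ) : (A ^ 2).re - (2 * ‖A‖ * ‖B‖ + ‖B‖ ^ 2) ≤ ((A - B) ^ 2).re := by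
  have h1 : (A - B) ^ 2 = A ^ 2 + (B ^ 2 - 2 * A * B) := by ring
  have h2 : |(B ^ 2 - 2 * A * B).re| ≤ ‖B ^ 2 - 2 * A * B‖ := Complex.abs_re_le_norm _
  have h3 : ‖B ^ 2 - 2 * A * B‖ ≤ ‖B‖ ^ 2 + 2 * ‖A‖ * ‖B‖ := by
    calc ‖B ^ 2 - 2 * A * B‖ ≤ ‖B ^ 2‖ + ‖2 * A * B‖ := norm_sub_le _ _
      _ = ‖B‖ ^ 2 + 2 * ‖A‖ * ‖B‖ := by
          rw [norm_pow, norm_mul, norm_mul, Complex.norm_ofNat]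
  rw [h1, Complex.add_re]
  linarith [(abs_le.1 h2).1]

/-- On the top layer `Re ρ = 1/2 + η₀`: `Re (e^{(ρ-1/2)a} F)² = e^{2η₀a} Re (e^{2i(Im ρ)a} F²)`.
[folklore] -/
theorem loc_re_sq_top {ρ : ℂ} {η₀ : ℝ} (hρ : ρ.re = 1 / 2 + η₀) (a : ℝ) (F : ℂ) :
    ((Complex.exp ((ρ - 1 / 2) * (a : ℂ)) * F) ^ 2).re =
      Real.exp (2 * η₀ * a) * (Complex.exp (2 * (ρ.im : ℂ) * (a : ℂ) * Complex.I) * F ^ 2).re := by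
  rw [mul_pow, loc_cexp_sq_of_re hρ a, mul_assoc, Complex.re_ofReal_mul]

/-- Norms of the exponential factors on the top layer: `‖e^{(ρ-1/2)a}‖ = e^{η₀a}` and
`‖e^{-(ρ-1/2)a}‖ = e^{-η₀a}` for `Re ρ = 1/2 + η₀`. [folklore] -/
theorem loc_norm_cexp_top {ρ : ℂ} {η₀ : ℝ} (hρ : ρ.re = 1 / 2 + η₀) (a : ℝ) :
    ‖Complex.exp ((ρ - 1 / 2) * (a : ℂ))‖ = Real.exp (η₀ * a) ∧
      ‖Complex.exp (-((ρ - 1 / 2) * (a : ℂ)))‖ = Real.exp (-(η₀ * a)) := by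
  have hre : (ρ - 1 / 2).re = η₀ := by simp [hρ]
  constructor
  · rw [loc_norm_cexp_mul, hre]
  · rw [show -((ρ - 1 / 2) * (a : ℂ)) = (-(ρ - 1 / 2)) * (a : ℂ) by ring, loc_norm_cexp_mul,
      Complex.neg_re, hre, neg_mul]

/-- Norms of the exponential factors on a lower layer: for `|Re ρ - 1/2| ≤ η'` and `a ≥ 0`,
`‖e^{±(ρ-1/2)a}‖ ≤ e^{η'a}`. [folklore] -/
theorem loc_norm_cexp_low {ρ : ℂ} {η' a : ℝ} (hρ : |ρ.re - 1 / 2| ≤ η') (ha : 0 ≤ a) :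
    ‖Complex.exp ((ρ - 1 / 2) * (a : ℂ))‖ ≤ Real.exp (η' * a) ∧
      ‖Complex.exp (-((ρ - 1 / 2) * (a : ℂ)))‖ ≤ Real.exp (η' * a) := by
  have hre : (ρ - 1 / 2).re = ρ.re - 1 / 2 := by simp
  have h1 : (ρ.re - 1 / 2) * a ≤ η' * a :=
    mul_le_mul_of_nonneg_right ((le_abs_self _).trans hρ) ha
  have h2 : -((ρ.re - 1 / 2) * a) ≤ η' * a := by
    rw [← neg_mul]
    exact mul_le_mul_of_nonneg_right ((neg_le_abs _).trans hρ) ha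
  constructor
  · rw [loc_norm_cexp_mul, hre]
    exact Real.exp_le_exp.2 h1
  · rw [show -((ρ - 1 / 2) * (a : ℂ)) = (-(ρ - 1 / 2)) * (a : ℂ) by ring, loc_norm_cexp_mul,
      Complex.neg_re, hre, neg_mul]
    exact Real.exp_le_exp.2 h2

/-- **Top layer, one point.**  For `Re ρ = 1/2 + η₀` with `η₀ ≥ 0`, `a ≥ 0` and
`X = e^{(ρ-1/2)a} F - e^{-(ρ-1/2)a} G`:
`Re X² ≥ e^{2η₀a} Re (e^{2i(Im ρ)a} F²) - (‖F‖ + ‖G‖)²`. [folklore] -/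
theorem loc_layer_top_pt {ρ : ℂ} {η₀ a : ℝ} (hρ : ρ.re = 1 / 2 + η₀) (hη₀ : 0 ≤ η₀)
    (ha : 0 ≤ a) (F G : ℂ) :
    Real.exp (2 * η₀ * a) * (Complex.exp (2 * (ρ.im : ℂ) * (a : ℂ) * Complex.I) * F ^ 2).re -
        (‖F‖ + ‖G‖) ^ 2 ≤
      ((Complex.exp ((ρ - 1 / 2) * (a : ℂ)) * F -
        Complex.exp (-((ρ - 1 / 2) * (a : ℂ))) * G) ^ 2).re := by
  set A : ℂ := Complex.exp ((ρ - 1 / 2) * (a : ℂ)) * F with hA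
  set B : ℂ := Complex.exp (-((ρ - 1 / 2) * (a : ℂ))) * G with hB
  obtain ⟨hn1, hn2⟩ := loc_norm_cexp_top hρ a
  have hAn : ‖A‖ = Real.exp (η₀ * a) * ‖F‖ := by rw [hA, norm_mul, hn1]
  have hBn : ‖B‖ = Real.exp (-(η₀ * a)) * ‖G‖ := by rw [hB, norm_mul, hn2]
  have hAB : ‖A‖ * ‖B‖ = ‖F‖ * ‖G‖ := by
    rw [hAn, hBn]
    have : Real.exp (η₀ * a) * Real.exp (-(η₀ * a)) = 1 := by
      rw [← Real.exp_add, add_neg_cancel, Real.exp_zero]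
    linear_combination ‖F‖ * ‖G‖ * this
  have hB2 : ‖B‖ ^ 2 ≤ ‖G‖ ^ 2 := by
    rw [hBn]
    have h1 : Real.exp (-(η₀ * a)) ≤ 1 := Real.exp_le_one_iff.2 (by nlinarith)
    have h0 : 0 ≤ Real.exp (-(η₀ * a)) := (Real.exp_pos _).le
    have : Real.exp (-(η₀ * a)) * ‖G‖ ≤ ‖G‖ := mul_le_of_le_one_left (norm_nonneg _) h1
    exact pow_le_pow_left₀ (mul_nonneg h0 (norm_nonneg _)) this 2
  have key := loc_re_sub_sq_ge A B
  rw [hA] at key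
  rw [loc_re_sq_top hρ a F] at key
  rw [← hA] at key
  have h4 : 2 * ‖A‖ * ‖B‖ + ‖B‖ ^ 2 ≤ (‖F‖ + ‖G‖) ^ 2 := by
    have hFG : 0 ≤ ‖F‖ * ‖G‖ := mul_nonneg (norm_nonneg _) (norm_nonneg _)
    have hexp : (‖F‖ + ‖G‖) ^ 2 = ‖F‖ ^ 2 + 2 * (‖F‖ * ‖G‖) + ‖G‖ ^ 2 := by ring
    have h2AB : 2 * ‖A‖ * ‖B‖ = 2 * (‖F‖ * ‖G‖) := by rw [mul_assoc, hAB]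
    rw [hexp, h2AB]
    nlinarith [sq_nonneg ‖F‖]
  linarith [key, h4]

/-- **Lower layer, one point.**  For `|Re ρ - 1/2| ≤ η'`, `a ≥ 0` and
`X = e^{(ρ-1/2)a} F - e^{-(ρ-1/2)a} G`: `Re X² ≥ -e^{2η'a} (‖F‖ + ‖G‖)²`. [folklore] -/
theorem loc_layer_low_pt {ρ : ℂ} {η' a : ℝ} (hρ : |ρ.re - 1 / 2| ≤ η') (ha : 0 ≤ a) (F G : ℂ) :
    -(Real.exp (2 * η' * a) * (‖F‖ + ‖G‖) ^ 2) ≤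
      ((Complex.exp ((ρ - 1 / 2) * (a : ℂ)) * F -
        Complex.exp (-((ρ - 1 / 2) * (a : ℂ))) * G) ^ 2).re := by
  set X : ℂ := Complex.exp ((ρ - 1 / 2) * (a : ℂ)) * F -
    Complex.exp (-((ρ - 1 / 2) * (a : ℂ))) * G with hX
  obtain ⟨hn1, hn2⟩ := loc_norm_cexp_low hρ ha
  have hXn : ‖X‖ ≤ Real.exp (η' * a) * (‖F‖ + ‖G‖) := by
    calc ‖X‖ ≤ ‖Complex.exp ((ρ - 1 / 2) * (a : ℂ)) * F‖ +
          ‖Complex.exp (-((ρ - 1 / 2) * (a : ℂ))) * G‖ := norm_sub_le _ _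
      _ = ‖Complex.exp ((ρ - 1 / 2) * (a : ℂ))‖ * ‖F‖ +
          ‖Complex.exp (-((ρ - 1 / 2) * (a : ℂ)))‖ * ‖G‖ := by rw [norm_mul, norm_mul]
      _ ≤ Real.exp (η' * a) * ‖F‖ + Real.exp (η' * a) * ‖G‖ :=
          add_le_add (mul_le_mul_of_nonneg_right hn1 (norm_nonneg _))
            (mul_le_mul_of_nonneg_right hn2 (norm_nonneg _))
      _ = Real.exp (η' * a) * (‖F‖ + ‖G‖) := by ring
  have h1 := trial_neg_norm_sq_le_re_sq X
  have h2 : ‖X‖ ^ 2 ≤ (Real.exp (η' * a) * (‖F‖ + ‖G‖)) ^ 2 :=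
    pow_le_pow_left₀ (norm_nonneg _) hXn 2
  have h3 : (Real.exp (η' * a) * (‖F‖ + ‖G‖)) ^ 2 = Real.exp (2 * η' * a) * (‖F‖ + ‖G‖) ^ 2 := by
    rw [mul_pow, ← Real.exp_nat_mul]
    congr 2
    push_cast
    ring
  linarith

/-- **Top layer** (registered sub-goal of the item, closed form).  For a finite set `T` of points
with `Re ρ = 1/2 + η₀` (`η₀ ≥ 0`), non-negative weights `w`, `a ≥ 0`, and values
`X(ρ) = e^{(ρ-1/2)a} F(ρ) - e^{-(ρ-1/2)a} G(ρ)` on `T`: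
`e^{2η₀a} Σ_T w Re(e^{2i(Im ρ)a} F²) - Σ_T w (‖F‖ + ‖G‖)² ≤ Σ_T w Re X²`. [folklore] -/
theorem loc_layer_top :
    ∀ (T : Finset ℂ) (w : ℂ → ℝ) (η₀ a : ℝ), 0 ≤ η₀ → 0 ≤ a → (∀ ρ ∈ T, ρ.re = 1 / 2 + η₀) →
      (∀ ρ ∈ T, 0 ≤ w ρ) → ∀ (X F G : ℂ → ℂ),
      (∀ ρ ∈ T, X ρ = Complex.exp ((ρ - 1 / 2) * (a : ℂ)) * F ρ -
        Complex.exp (-((ρ - 1 / 2) * (a : ℂ))) * G ρ) →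
      Real.exp (2 * η₀ * a) *
            ∑ ρ ∈ T, w ρ * (Complex.exp (2 * (ρ.im : ℂ) * (a : ℂ) * Complex.I) * F ρ ^ 2).re -
          ∑ ρ ∈ T, w ρ * (‖F ρ‖ + ‖G ρ‖) ^ 2 ≤
        ∑ ρ ∈ T, w ρ * (X ρ ^ 2).re := by
  intro T w η₀ a hη₀ ha hTre hw X F G hX
  rw [Finset.mul_sum, ← Finset.sum_sub_distrib]
  refine Finset.sum_le_sum fun ρ hρ ↦ ?_
  have h := loc_layer_top_pt (hTre ρ hρ) hη₀ ha (F ρ) (G ρ)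
  rw [← hX ρ hρ] at h
  have hw' := hw ρ hρ
  nlinarith

/-- **Lower layers** (closed form).  For a finite set `E` of points with `|Re ρ - 1/2| ≤ η'`
(`η' ≥ 0`), non-negative weights `w`, `a ≥ 0`, and values
`X(ρ) = e^{(ρ-1/2)a} F(ρ) - e^{-(ρ-1/2)a} G(ρ)` on `E`:
`-e^{2η'a} Σ_E w (‖F‖ + ‖G‖)² ≤ Σ_E w Re X²`. [folklore] -/
theorem loc_layer_low :
    ∀ (E : Finset ℂ) (w : ℂ → ℝ) (η' a : ℝ), 0 ≤ η' → 0 ≤ a → (∀ ρ ∈ E, |ρ.re - 1 / 2| ≤ η') →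
      (∀ ρ ∈ E, 0 ≤ w ρ) → ∀ (X F G : ℂ → ℂ),
      (∀ ρ ∈ E, X ρ = Complex.exp ((ρ - 1 / 2) * (a : ℂ)) * F ρ -
        Complex.exp (-((ρ - 1 / 2) * (a : ℂ))) * G ρ) →
      -(Real.exp (2 * η' * a) * ∑ ρ ∈ E, w ρ * (‖F ρ‖ + ‖G ρ‖) ^ 2) ≤
        ∑ ρ ∈ E, w ρ * (X ρ ^ 2).re := by
  intro E w η' a _ ha hEoff hw X F G hX
  rw [Finset.mul_sum, ← Finset.sum_neg_distrib]
  refine Finset.sum_le_sum fun ρ hρ ↦ ?_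
  have h := loc_layer_low_pt (hEoff ρ hρ) ha (F ρ) (G ρ)
  rw [← hX ρ hρ] at h
  have hw' := hw ρ hρ
  nlinarith

end Summit.RiemannHypothesis.RiemannHypothesis.Theorems.WeilParityOffLineParityDetection

end
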